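import Summits.ValiantsHypothesis.ValiantsHypothesis.Theses.DivisionGap
import Literature.Barriers.ValiantsHypothesis.MonotoneGapParseTrees
import Literature.Computability.AlgebraicComplexity.ArithCircuitProofs

/-!
# `ZeroOneTransfer` — negative-side infrastructure: initial forms are free for monotone circuits

Crux `stmt-ValiantsHypothesis-5066` (`Theses.DivisionGap.ZeroOneTransfer`, route DivisionGap).
Standing disprover (cdisprove), `Cruxes/ZeroOneTransfer/Disproof.lean` §(B2).

For a weight `w : σ → ℕ` on the variables and `p ∈ ℝ≥0[σ]`, `topComponent w p` is the sum of the
terms of `p` of maximal `w`-weight (the initial form of `p` in direction `-w`).  Over the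
semiring `ℝ≥0` there is no cancellation, so in a fan-in-two circuit every gate can be PRUNED to
compute the top component of its value: a sum gate keeps the operands of maximal weight, a
product gate is unchanged (`topComponent_mul`).  Hence

* `complexity_topComponent_le` — `L_{ℝ≥0}(top_w p) ≤ L_{ℝ≥0}(p)`: passing to an initial form costs
  nothing in the tree's monotone model.

This is the degeneration step of every division-robust monotone argument (`f·h = g` ⇒
`f · top_w h = top_w g` when `f` is `w`-homogeneous); it is used in `LowDegreeCofactor.lean` to
show that cofactors of degree `δ` buy at most `δ` rows of the spanning-tree polynomial.
[folklore]
-/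

namespace Summit.ValiantsHypothesis.ValiantsHypothesis.Theorems.ZeroOneTransfer.Negative

open Literature.Computability.AlgebraicComplexity Literature.Barriers.ValiantsHypothesis
open MvPolynomial Finset
open ArithCircuit (Gate Operand gateValues)
open scoped NNReal

noncomputable section

variable {σ : Type*}

/-! ### The top weighted component over `ℝ≥0` -/

/-- The top `w`-component of `p`: its terms of maximal `w`-weight (initial form in direction
`-w`). [folklore] -/
def topComponent (w : σ → ℕ) (p : MvPolynomial σ ℝ≥0) : MvPolynomial σ ℝ≥0 :=
  weightedHomogeneousComponent w (weightedTotalDegree w p) p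

variable (w : σ → ℕ)

/-- Coefficients of the top component. [folklore] -/
theorem coeff_topComponent (p : MvPolynomial σ ℝ≥0) (d : σ →₀ ℕ) :
    coeff d (topComponent w p) =
      if Finsupp.weight w d = weightedTotalDegree w p then coeff d p else 0 := by
  classical
  unfold topComponent
  convert coeff_weightedHomogeneousComponent (w := w) (weightedTotalDegree w p) p d

/-- `top 0 = 0`. [folklore] -/
@[simp] theorem topComponent_zero : topComponent w (0 : MvPolynomial σ ℝ≥0) = 0 := by
  simp [topComponent]

/-- A weighted-homogeneous polynomial is its own top component. [folklore] -/
theorem topComponent_eq_self_of_isWeightedHomogeneous {p : MvPolynomial σ ℝ≥0} {n : ℕ}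
    (hp : IsWeightedHomogeneous w p n) : topComponent w p = p := by
  by_cases h0 : p = 0
  · simp [h0]
  have h1 := hp.weighted_total_degree h0
  rw [weightedTotalDegree_coe w p h0] at h1
  have h2 : weightedTotalDegree w p = n := WithBot.coe_injective h1
  unfold topComponent
  rw [h2]
  exact hp.weightedHomogeneousComponent_same

/-- `top (X i) = X i`. [folklore] -/
@[simp] theorem topComponent_X (i : σ) : topComponent w (X i : MvPolynomial σ ℝ≥0) = X i :=
  topComponent_eq_self_of_isWeightedHomogeneous w (isWeightedHomogeneous_X ℝ≥0 w i)

/-- `top (C c) = C c`. [folklore] -/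
@[simp] theorem topComponent_C (c : ℝ≥0) : topComponent w (C c : MvPolynomial σ ℝ≥0) = C c :=
  topComponent_eq_self_of_isWeightedHomogeneous w (isWeightedHomogeneous_C w c)

/-- A nonzero polynomial has a nonzero top component. [folklore] -/
theorem topComponent_ne_zero {p : MvPolynomial σ ℝ≥0} (hp : p ≠ 0) : topComponent w p ≠ 0 := by
  classical
  have hne : p.support.Nonempty := support_nonempty.mpr hp
  obtain ⟨d, hd, hsup⟩ := Finset.exists_mem_eq_sup p.support hne (Finsupp.weight w)
  intro h
  have := congrArg (coeff d) h
  rw [coeff_topComponent, coeff_zero, if_pos] at this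
  · exact (mem_support_iff.mp hd) this
  · rw [weightedTotalDegree, hsup]

/-- The top component is a sub-sum: its support lies in that of `p`. [folklore] -/
theorem support_topComponent_subset (p : MvPolynomial σ ℝ≥0) :
    (topComponent w p).support ⊆ p.support := by
  intro d hd
  rw [mem_support_iff, coeff_topComponent] at hd
  split_ifs at hd with h
  · exact mem_support_iff.mpr hd
  · exact absurd rfl hd

/-- Over `ℝ≥0`: the weighted degree of a product of nonzero polynomials is additive. [folklore] -/
theorem weightedTotalDegree_mul {p q : MvPolynomial σ ℝ≥0} (hp : p ≠ 0) (hq : q ≠ 0) :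
    weightedTotalDegree w (p * q) = weightedTotalDegree w p + weightedTotalDegree w q := by
  classical
  apply le_antisymm
  · refine Finset.sup_le fun d hd => ?_
    obtain ⟨a, ha, b, hb, rfl⟩ := Finset.mem_add.1 (support_mul p q hd)
    rw [map_add]
    exact add_le_add (le_weightedTotalDegree w ha) (le_weightedTotalDegree w hb)
  · obtain ⟨a, ha, hsa⟩ := Finset.exists_mem_eq_sup p.support (support_nonempty.mpr hp)
      (Finsupp.weight w)
    obtain ⟨b, hb, hsb⟩ := Finset.exists_mem_eq_sup q.support (support_nonempty.mpr hq)
      (Finsupp.weight w)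
    have hab : a + b ∈ (p * q).support := by
      rw [JerrumSnir.support_mul_eq]
      exact Finset.add_mem_add ha hb
    calc weightedTotalDegree w p + weightedTotalDegree w q
        = Finsupp.weight w a + Finsupp.weight w b := by rw [weightedTotalDegree, hsa,
            weightedTotalDegree, hsb]
      _ = Finsupp.weight w (a + b) := by rw [map_add]
      _ ≤ weightedTotalDegree w (p * q) := le_weightedTotalDegree w hab

/-- **Top components are multiplicative over `ℝ≥0`.** [folklore] -/
theorem topComponent_mul (p q : MvPolynomial σ ℝ≥0) :
    topComponent w (p * q) = topComponent w p * topComponent w q := by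
  classical
  by_cases hp : p = 0
  · simp [hp]
  by_cases hq : q = 0
  · simp [hq]
  have hD := weightedTotalDegree_mul w hp hq
  refine MvPolynomial.ext _ _ fun d => ?_
  rw [coeff_topComponent, coeff_mul, coeff_mul, hD]
  split_ifs with hwd
  · refine Finset.sum_congr rfl fun x hx => ?_
    rw [coeff_topComponent, coeff_topComponent]
    have hxd : x.1 + x.2 = d := Finset.HasAntidiagonal.mem_antidiagonal.mp hx
    by_cases hpa : coeff x.1 p = 0
    · simp [hpa]
    by_cases hqb : coeff x.2 q = 0
    · simp [hqb]
    have ha : Finsupp.weight w x.1 ≤ weightedTotalDegree w p :=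
      le_weightedTotalDegree w (mem_support_iff.mpr hpa)
    have hb : Finsupp.weight w x.2 ≤ weightedTotalDegree w q :=
      le_weightedTotalDegree w (mem_support_iff.mpr hqb)
    have hsum : Finsupp.weight w x.1 + Finsupp.weight w x.2 =
        weightedTotalDegree w p + weightedTotalDegree w q := by
      rw [← map_add, hxd, hwd]
    rw [if_pos (by omega), if_pos (by omega)]
  · symm
    refine Finset.sum_eq_zero fun x hx => ?_
    rw [coeff_topComponent, coeff_topComponent]
    have hxd : x.1 + x.2 = d := Finset.HasAntidiagonal.mem_antidiagonal.mp hx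
    split_ifs with h1 h2
    · exfalso; apply hwd
      rw [← hxd, map_add, h1, h2]
    · simp
    · simp
    · simp

/-- Over `ℝ≥0` a list sum of scalar multiples has the union of the supports of its effective
summands, so each effective summand has weighted degree at most that of the sum. [folklore] -/
theorem weightedTotalDegree_le_of_mem (L : List (ℝ≥0 × MvPolynomial σ ℝ≥0))
    {a : ℝ≥0 × MvPolynomial σ ℝ≥0} (ha : a ∈ L) (ha1 : a.1 ≠ 0) :
    weightedTotalDegree w a.2 ≤ weightedTotalDegree w (L.map fun b => b.1 • b.2).sum := by
  classical
  refine Finset.sup_le fun d hd => le_weightedTotalDegree w ?_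
  rw [JerrumSnir.mem_support_list_sum]
  refine ⟨a.1 • a.2, List.mem_map.mpr ⟨a, ha, rfl⟩, ?_⟩
  rwa [JerrumSnir.support_smul_eq ha1]

/-- Coefficients of a list sum. [folklore] -/
theorem coeff_list_sum' (d : σ →₀ ℕ) (L : List (MvPolynomial σ ℝ≥0)) :
    coeff d L.sum = (L.map (coeff d)).sum := by
  induction L with
  | nil => simp
  | cons p L ih => simp [List.sum_cons, coeff_add, ih]

/-- Sum over a filtered list as a sum with indicators. [folklore] -/
theorem list_sum_map_filter {α β : Type*} [AddCommMonoid β] (L : List α) (P : α → Bool)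
    (f : α → β) :
    ((L.filter P).map f).sum = (L.map fun a => if P a then f a else 0).sum := by
  induction L with
  | nil => simp
  | cons a L ih =>
    rw [List.filter_cons]
    by_cases h : P a = true
    · simp [h, ih]
    · simp [h, ih]

/-- **Top component of a weighted sum over `ℝ≥0`**: keep exactly the effective summands whose
weighted degree is that of the whole sum. [folklore] -/
theorem topComponent_list_sum [DecidableEq σ] (L : List (ℝ≥0 × MvPolynomial σ ℝ≥0)) :
    topComponent w (L.map fun b => b.1 • b.2).sum =
      ((L.filter fun b => decide (b.1 ≠ 0 ∧ b.2 ≠ 0 ∧ weightedTotalDegree w b.2 =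
          weightedTotalDegree w (L.map fun b => b.1 • b.2).sum)).map
        fun b => b.1 • topComponent w b.2).sum := by
  classical
  set S := (L.map fun b => b.1 • b.2).sum with hS
  have key : ∀ b ∈ L, ∀ d : σ →₀ ℕ,
      (if (b.1 ≠ 0 ∧ b.2 ≠ 0 ∧ weightedTotalDegree w b.2 = weightedTotalDegree w S) then
          b.1 * coeff d (topComponent w b.2) else 0) =
        if Finsupp.weight w d = weightedTotalDegree w S then b.1 * coeff d b.2 else 0 := by
    intro b hb d
    rw [coeff_topComponent]
    by_cases h1 : b.1 = 0
    · simp [h1]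
    by_cases h2 : b.2 = 0
    · simp [h2]
    by_cases h3 : weightedTotalDegree w b.2 = weightedTotalDegree w S
    · simp [h1, h2, h3]
    · rw [if_neg (by simp [h3])]
      split_ifs with h4
      · -- `deg b.2 < deg S = weight d`, so `d ∉ supp b.2`
        have hle : weightedTotalDegree w b.2 ≤ weightedTotalDegree w S :=
          hS ▸ weightedTotalDegree_le_of_mem w L hb h1
        have hlt : weightedTotalDegree w b.2 < Finsupp.weight w d :=
          lt_of_le_of_ne (h4 ▸ hle) (h4 ▸ h3)
        have : coeff d b.2 = 0 := by
          by_contra hne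
          exact absurd (le_weightedTotalDegree w (mem_support_iff.mpr hne)) (not_le.mpr hlt)
        rw [this, mul_zero]
      · rfl
  refine MvPolynomial.ext _ _ fun d => ?_
  rw [coeff_topComponent, list_sum_map_filter, coeff_list_sum', coeff_list_sum', List.map_map,
    List.map_map]
  have hR : (L.map (coeff d ∘ fun a => if decide (a.1 ≠ 0 ∧ a.2 ≠ 0 ∧
      weightedTotalDegree w a.2 = weightedTotalDegree w S) then a.1 • topComponent w a.2
      else 0)) = L.map fun b =>
        if Finsupp.weight w d = weightedTotalDegree w S then b.1 * coeff d b.2 else 0 := by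
    refine List.map_congr_left fun b hb => ?_
    rw [← key b hb d]
    simp only [Function.comp_apply, decide_eq_true_eq]
    split_ifs <;> simp [coeff_smul]
  rw [hR]
  by_cases hwd : Finsupp.weight w d = weightedTotalDegree w S
  · simp only [hwd, if_true]
    exact congrArg List.sum (List.map_congr_left fun b _ => by
      simp only [Function.comp_apply, coeff_smul, smul_eq_mul])
  · simp only [hwd, if_false]
    symm
    exact List.sum_eq_zero (fun x hx => by
      obtain ⟨b, -, rfl⟩ := List.mem_map.mp hx; rfl)


/-- `top 1 = 1`. [folklore] -/
@[simp] theorem topComponent_one : topComponent w (1 : MvPolynomial σ ℝ≥0) = 1 := by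
  rw [← C_1]; exact topComponent_C w 1

/-- Top components of list products. [folklore] -/
theorem topComponent_list_prod (l : List (MvPolynomial σ ℝ≥0)) :
    topComponent w l.prod = (l.map (topComponent w)).prod := by
  induction l with
  | nil => simp
  | cons p l ih => rw [List.prod_cons, topComponent_mul, ih, List.map_cons, List.prod_cons]

/-! ### Pruning a fan-in-two circuit over `ℝ≥0` to the top component -/

open Classical in
/-- Prune one gate against the ORIGINAL values `vals` of the earlier gates: a sum gate keeps its
effective operands whose value has the top weighted degree of the gate's value; a product gate
is unchanged. [folklore] -/
def pruneGate (vals : List (MvPolynomial σ ℝ≥0)) : Gate ℝ≥0 σ → Gate ℝ≥0 σ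
  | .sum args => .sum (args.filter fun a => decide (a.1 ≠ 0 ∧ a.2.eval vals ≠ 0 ∧
      weightedTotalDegree w (a.2.eval vals) =
        weightedTotalDegree w ((args.map fun b => b.1 • b.2.eval vals).sum)))
  | .prod args => .prod args

/-- Prune a gate list, threading the original gate values (a left fold, like `gateValues`).
[folklore] -/
def pruneAux (gs : List (Gate ℝ≥0 σ)) : List (Gate ℝ≥0 σ) × List (MvPolynomial σ ℝ≥0) :=
  gs.foldl (fun acc g => (acc.1 ++ [pruneGate w acc.2 g], acc.2 ++ [g.eval acc.2])) ([], [])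

/-- One step of the fold. [folklore] -/
theorem pruneAux_append_singleton (gs : List (Gate ℝ≥0 σ)) (g : Gate ℝ≥0 σ) :
    pruneAux w (gs ++ [g]) =
      ((pruneAux w gs).1 ++ [pruneGate w (pruneAux w gs).2 g],
        (pruneAux w gs).2 ++ [g.eval (pruneAux w gs).2]) := by
  simp [pruneAux, List.foldl_append]

/-- The threaded values are the original gate values. [folklore] -/
theorem pruneAux_snd (gs : List (Gate ℝ≥0 σ)) : (pruneAux w gs).2 = gateValues gs := by
  induction gs using List.reverseRecOn with
  | nil => rfl
  | append_singleton gs g ih =>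
    rw [pruneAux_append_singleton, ArithCircuit.gateValues_append_singleton, ih]

/-- Pruning keeps the number of gates. [folklore] -/
theorem pruneAux_length (gs : List (Gate ℝ≥0 σ)) : (pruneAux w gs).1.length = gs.length := by
  induction gs using List.reverseRecOn with
  | nil => rfl
  | append_singleton gs g ih => simp [pruneAux_append_singleton, ih]

/-- Every pruned gate is the pruning of an original gate. [folklore] -/
theorem mem_pruneAux {gs : List (Gate ℝ≥0 σ)} {g : Gate ℝ≥0 σ} (hg : g ∈ (pruneAux w gs).1) :
    ∃ vals g₀, g₀ ∈ gs ∧ g = pruneGate w vals g₀ := by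
  induction gs using List.reverseRecOn with
  | nil => simp [pruneAux] at hg
  | append_singleton gs g' ih =>
    rw [pruneAux_append_singleton] at hg
    simp only [List.mem_append, List.mem_singleton] at hg
    rcases hg with hg | rfl
    · obtain ⟨vals, g₀, h₀, rfl⟩ := ih hg
      exact ⟨vals, g₀, List.mem_append_left _ h₀, rfl⟩
    · exact ⟨_, g', by simp, rfl⟩

/-- Pruning does not increase the fan-in. [folklore] -/
theorem fanIn_pruneGate_le (vals : List (MvPolynomial σ ℝ≥0)) (g : Gate ℝ≥0 σ) :
    (pruneGate w vals g).fanIn ≤ g.fanIn := by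
  cases g with
  | sum args =>
    simp only [pruneGate, Gate.fanIn, ArithCircuit.Gate.args, List.length_map]
    exact List.length_filter_le _ _
  | prod args => simp [pruneGate]

/-- Operands read top components off the list of top components. [folklore] -/
theorem operand_eval_map_topComponent (vals : List (MvPolynomial σ ℝ≥0)) (u : Operand ℝ≥0 σ) :
    u.eval (vals.map (topComponent w)) = topComponent w (u.eval vals) := by
  cases u with
  | var i => simp [Operand.eval]
  | const c => simp [Operand.eval]
  | gate j =>
    simp only [ArithCircuit.Operand.eval_gate, List.getD_eq_getElem?_getD, List.getElem?_map]
    cases vals[j]? with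
    | none => simp
    | some v => simp

/-- **The pruned gate computes the top component of the original gate's value** (over `ℝ≥0`:
`topComponent_list_sum` for sum gates, `topComponent_mul` for product gates). [folklore] -/
theorem pruneGate_eval [DecidableEq σ] (vals : List (MvPolynomial σ ℝ≥0)) (g : Gate ℝ≥0 σ) :
    (pruneGate w vals g).eval (vals.map (topComponent w)) = topComponent w (g.eval vals) := by
  classical
  cases g with
  | sum args =>
    simp only [pruneGate, Gate.eval]
    have hS : ((args.map fun a => (a.1, a.2.eval vals)).map fun b => b.1 • b.2) =
        args.map fun b => b.1 • b.2.eval vals := by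
      rw [List.map_map]; rfl
    rw [← hS, topComponent_list_sum]
    simp only [List.filter_map, List.map_map, list_sum_map_filter, Function.comp_def,
      operand_eval_map_topComponent]
  | prod args =>
    simp only [pruneGate, Gate.eval]
    rw [topComponent_list_prod, List.map_map]
    congr 1
    refine List.map_congr_left fun u _ => ?_
    simp only [Function.comp_apply, operand_eval_map_topComponent]

/-- The pruned circuit: pruned gates, same output operand. [folklore] -/
def prune (P : ArithCircuit ℝ≥0 σ) : ArithCircuit ℝ≥0 σ where
  gates := (pruneAux w P.gates).1
  output := P.output

/-- **The values of the pruned gates are the top components of the original values.**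
[folklore] -/
theorem gateValues_pruneAux [DecidableEq σ] (gs : List (Gate ℝ≥0 σ)) :
    gateValues (pruneAux w gs).1 = (gateValues gs).map (topComponent w) := by
  induction gs using List.reverseRecOn with
  | nil => rfl
  | append_singleton gs g ih =>
    rw [pruneAux_append_singleton, ArithCircuit.gateValues_append_singleton,
      ArithCircuit.gateValues_append_singleton, ih, pruneAux_snd, List.map_append,
      List.map_singleton, pruneGate_eval]

/-- The pruned circuit computes the top component. [folklore] -/
theorem eval_prune [DecidableEq σ] (P : ArithCircuit ℝ≥0 σ) :
    (prune w P).eval = topComponent w P.eval := by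
  simp only [ArithCircuit.eval, prune]
  rw [gateValues_pruneAux, operand_eval_map_topComponent]

/-- Pruning keeps the size. [folklore] -/
theorem size_prune (P : ArithCircuit ℝ≥0 σ) : (prune w P).size = P.size :=
  pruneAux_length w P.gates

/-- Pruning keeps fan-in two. [folklore] -/
theorem isFanInTwo_prune {P : ArithCircuit ℝ≥0 σ} (h : P.IsFanInTwo) :
    (prune w P).IsFanInTwo := by
  intro g hg
  obtain ⟨vals, g₀, h₀, rfl⟩ := mem_pruneAux w hg
  exact (fanIn_pruneGate_le w vals g₀).trans (h g₀ h₀)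

/-- **Initial forms are free for monotone circuits over `ℝ≥0`**: `L(top_w p) ≤ L(p)` in the
tree's fan-in-two `complexity` over the semiring `ℝ≥0`, for every weight `w : σ → ℕ`.
[folklore] -/
theorem complexity_topComponent_le (p : MvPolynomial σ ℝ≥0) :
    complexity (topComponent w p) ≤ complexity p := by
  classical
  obtain ⟨P, h2, hP, hsize⟩ := ArithCircuit.exists_computes_size_eq_complexity p
  rw [← hsize, ← size_prune w P]
  refine ArithCircuit.complexity_le_size (isFanInTwo_prune w h2) ?_
  show (prune w P).eval = topComponent w p
  rw [eval_prune, show P.eval = p from hP]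

end

end Summit.ValiantsHypothesis.ValiantsHypothesis.Theorems.ZeroOneTransfer.Negative
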